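import Mathlib
import Summits.CriticalPhenomena.PercolationContinuityZ3.Theorems.PercNearOneGluingNoHeavyLowerTailTNKernels
import Summits.CriticalPhenomena.PercolationContinuityZ3.Theorems.PercNearOneGluingNoHeavyLowerTailBandTwoTN
import HarnessLib

/-!
# Pivot inequalities for the operator Hurwitz matrix of two copies (THEOREM R₂, scalar part)

Support file for the Sahi / Conjecture-P programme of route `PercNearOneGluingNoHeavy`
(`--supports stmt-CriticalPhenomena-4575`, prover prim-l12-p5 gen 46; proof note
`prim-l12-p5/PROOF-HURWITZ-TRANSFER-g46.md` §3, `prim-l12-p5/LEAN-BLUEPRINT-3_0-g46.md`).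
No definitions, no named facts, no sorries.

For two copies `φ_j = b_j + g_j X` (`b_j > 0`, `0 < g_j ≤ 1`) at level `q > 0` the operator Hurwitz matrix
`R(W) = interleave(W, [S,W])` of the λ-free band matrix is eliminated by a five-stage adjacent-row
(Whitney) elimination with explicit pivots (memo §3).  This file contains the scalar inequalities that make
all multipliers nonnegative, and the one-step closure lemma used to chain the stages:

* `HurwitzPair.keyPoly_pos` — the key polynomial
  `𝒫(n) = 2q(q(b₁-b₂)² + (b₁+b₂)² - 2(b₁²g₂+b₂²g₁)) + 4q(b₁-b₂)(b₁g₂-b₂g₁) n + 2(b₁g₂-b₂g₁)² n(n-1)` is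
  `> 0` for `n ≥ 1` when `g₁ < 1`, via the identity
  `(n+q)𝒫 = 2(n+q-1)((n+q)Δ - τn)² + 2q²τ² + 2q(n+q)(2K-τ²)` (`Δ = b₁-b₂`, `τ = b₁h₂-b₂h₁`,
  `K = b₁²h₂+b₂²h₁`, `h = 1-g`) and `2K - τ² ≥ b₂²h₁(2-h₁) > 0`;
* `HurwitzPair.boundaryPivot_pos` — positivity of the numerator of the boundary pivot `ŵ(2)`;
* `HurwitzPair.step_tn` — if `M` is a TN kernel and `e ≥ 0` with `e 0 = 0` then
  `(t,l) ↦ M t l + e t · M (t-1) l` is TN (left multiplication by a unit lower bidiagonal kernel).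
-/

namespace Summit.CriticalPhenomena.PercolationContinuityZ3.Theorems

namespace HurwitzPair

open Finset Matrix

/-- **The key pivot polynomial is positive.**  For `b₁, b₂ > 0`, `0 < g₁ < 1`, `0 < g₂ ≤ 1`, `q > 0`,
`n ≥ 1`:  `2q(q(b₁-b₂)² + (b₁+b₂)² - 2(b₁²g₂+b₂²g₁)) + 4q(b₁-b₂)(b₁g₂-b₂g₁)·n + 2(b₁g₂-b₂g₁)²·n(n-1) > 0`. -/
theorem keyPoly_pos (b₁ b₂ g₁ g₂ q n : ℝ) (hb₁ : 0 < b₁) (hb₂ : 0 < b₂) (hg₁ : 0 < g₁) (hg₁' : g₁ < 1)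
    (hg₂ : 0 < g₂) (hg₂' : g₂ ≤ 1) (hq : 0 < q) (hn : 1 ≤ n) :
    0 < 2 * q * (q * (b₁ - b₂) ^ 2 + (b₁ + b₂) ^ 2 - 2 * (b₁ ^ 2 * g₂ + b₂ ^ 2 * g₁))
      + 4 * q * (b₁ - b₂) * (b₁ * g₂ - b₂ * g₁) * n + 2 * (b₁ * g₂ - b₂ * g₁) ^ 2 * (n * (n - 1)) := by
  set h₁ : ℝ := 1 - g₁ with hh₁
  set h₂ : ℝ := 1 - g₂ with hh₂
  have hh₁pos : 0 < h₁ := by rw [hh₁]; linarith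
  have hh₁le : h₁ ≤ 1 := by rw [hh₁]; linarith
  have hh₂nn : 0 ≤ h₂ := by rw [hh₂]; linarith
  have hh₂le : h₂ ≤ 1 := by rw [hh₂]; linarith
  set τ : ℝ := b₁ * h₂ - b₂ * h₁ with hτ
  set K : ℝ := b₁ ^ 2 * h₂ + b₂ ^ 2 * h₁ with hK
  set Δ : ℝ := b₁ - b₂ with hΔ
  set P : ℝ := 2 * q * (q * (b₁ - b₂) ^ 2 + (b₁ + b₂) ^ 2 - 2 * (b₁ ^ 2 * g₂ + b₂ ^ 2 * g₁))
      + 4 * q * (b₁ - b₂) * (b₁ * g₂ - b₂ * g₁) * n + 2 * (b₁ * g₂ - b₂ * g₁) ^ 2 * (n * (n - 1)) with hP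
  -- the sum-of-squares identity
  have hid : (n + q) * P = 2 * (n + q - 1) * ((n + q) * Δ - τ * n) ^ 2 + 2 * q ^ 2 * τ ^ 2
      + 2 * q * (n + q) * (2 * K - τ ^ 2) := by
    have eg₁ : g₁ = 1 - h₁ := by rw [hh₁]; ring
    have eg₂ : g₂ = 1 - h₂ := by rw [hh₂]; ring
    rw [hP, hτ, hK, hΔ, eg₁, eg₂]; ring
  -- 2K - τ² ≥ b₂² h₁ (2 - h₁) > 0
  have hKτ : 2 * K - τ ^ 2 = b₁ ^ 2 * (h₂ * (2 - h₂)) + b₂ ^ 2 * (h₁ * (2 - h₁)) + 2 * b₁ * b₂ * h₁ * h₂ := by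
    rw [hK, hτ]; ring
  have hKτpos : 0 < 2 * K - τ ^ 2 := by
    rw [hKτ]
    have t1 : 0 ≤ b₁ ^ 2 * (h₂ * (2 - h₂)) := mul_nonneg (sq_nonneg _) (mul_nonneg hh₂nn (by linarith))
    have t2 : 0 < b₂ ^ 2 * (h₁ * (2 - h₁)) := mul_pos (pow_pos hb₂ 2) (mul_pos hh₁pos (by linarith))
    have t3 : 0 ≤ 2 * b₁ * b₂ * h₁ * h₂ := by
      have := mul_nonneg (mul_nonneg (mul_nonneg hb₁.le hb₂.le) hh₁pos.le) hh₂nn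
      nlinarith
    linarith
  have hnq : 0 < n + q := by linarith
  have hrhs : 0 < (n + q) * P := by
    rw [hid]
    have s1 : 0 ≤ 2 * (n + q - 1) * ((n + q) * Δ - τ * n) ^ 2 :=
      mul_nonneg (mul_nonneg two_pos.le (by linarith)) (sq_nonneg _)
    have s2 : 0 ≤ 2 * q ^ 2 * τ ^ 2 := by positivity
    have s3 : 0 < 2 * q * (n + q) * (2 * K - τ ^ 2) := by positivity
    linarith
  exact pos_of_mul_pos_right hrhs hnq.le

/-- **Boundary pivot numerator.**  For `b₁, b₂ > 0`, `0 ≤ g_j ≤ 1`, `q > 0`: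
`q²(b₁²+b₂²) + q(b₁²(1+2g₂) + b₂²(1+2g₁) + 2b₁b₂(1-g₁-g₂)) + 2(b₁g₂-b₂g₁)² > 0`. -/
theorem boundaryPivot_pos (b₁ b₂ g₁ g₂ q : ℝ) (hb₁ : 0 < b₁) (hb₂ : 0 < b₂) (hg₁ : 0 ≤ g₁) (hg₁' : g₁ ≤ 1)
    (hg₂ : 0 ≤ g₂) (hg₂' : g₂ ≤ 1) (hq : 0 < q) :
    0 < q ^ 2 * (b₁ ^ 2 + b₂ ^ 2)
      + q * (b₁ ^ 2 * (1 + 2 * g₂) + b₂ ^ 2 * (1 + 2 * g₁) + 2 * b₁ * b₂ * (1 - g₁ - g₂))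
      + 2 * (b₁ * g₂ - b₂ * g₁) ^ 2 := by
  have hbr : 0 ≤ b₁ ^ 2 * (1 + 2 * g₂) + b₂ ^ 2 * (1 + 2 * g₁) + 2 * b₁ * b₂ * (1 - g₁ - g₂) := by
    have e : b₁ ^ 2 * (1 + 2 * g₂) + b₂ ^ 2 * (1 + 2 * g₁) + 2 * b₁ * b₂ * (1 - g₁ - g₂)
        = (b₁ - b₂) ^ 2 + 2 * g₂ * b₁ ^ 2 + 2 * g₁ * b₂ ^ 2 + 2 * b₁ * b₂ * (2 - g₁ - g₂) := by ring
    rw [e]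
    have t1 : 0 ≤ 2 * g₂ * b₁ ^ 2 := by positivity
    have t2 : 0 ≤ 2 * g₁ * b₂ ^ 2 := by positivity
    have t3 : 0 ≤ 2 * b₁ * b₂ * (2 - g₁ - g₂) :=
      mul_nonneg (by positivity) (by linarith)
    nlinarith [sq_nonneg (b₁ - b₂)]
  have t0 : 0 < q ^ 2 * (b₁ ^ 2 + b₂ ^ 2) := by positivity
  have t4 : 0 ≤ q * (b₁ ^ 2 * (1 + 2 * g₂) + b₂ ^ 2 * (1 + 2 * g₁) + 2 * b₁ * b₂ * (1 - g₁ - g₂)) :=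
    mul_nonneg hq.le hbr
  have t5 : 0 ≤ 2 * (b₁ * g₂ - b₂ * g₁) ^ 2 := by positivity
  linarith

/-- **One elimination stage preserves total nonnegativity.**  If the kernel `M` is totally nonnegative
and `e ≥ 0` with `e 0 = 0`, then `(t,l) ↦ M t l + e t · M (t-1) l` — the product of the unit lower
bidiagonal kernel `[s = t] + [s+1 = t] e t` with `M` — is totally nonnegative. -/
theorem step_tn (M : ℕ → ℕ → ℝ) (e : ℕ → ℝ) (he : ∀ t, 0 ≤ e t) (he0 : e 0 = 0)
    (hM : ∀ (k : ℕ) (r c : Fin k → ℕ), StrictMono r → StrictMono c →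
      0 ≤ (Matrix.of fun i j => M (r i) (c j)).det)
    {k : ℕ} (r c : Fin k → ℕ) (hr : StrictMono r) (hc : StrictMono c) :
    0 ≤ (Matrix.of fun i j => M (r i) (c j) + e (r i) * M (r i - 1) (c j)).det := by
  have heq : (Matrix.of fun i j => M (r i) (c j) + e (r i) * M (r i - 1) (c j)) =
      Matrix.of fun i j => ∑ t ∈ range (r i + 1),
        (if t = r i then (1 : ℝ) else if t + 1 = r i then e (r i) else 0) * M t (c j) := by
    ext i j
    rw [Matrix.of_apply, Matrix.of_apply,
      BandTwoTN.sum_bidiag (fun _ => (1 : ℝ)) e (fun t => M t (c j)) he0 (r i), one_mul]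
  rw [heq]
  set N := (univ.sup r) + (univ.sup c) + 1 with hN
  refine TNKernel.mulLower_minor_nonneg
    (fun n t => if t = n then (1 : ℝ) else if t + 1 = n then e n else 0)
    M N ?_ ?_ ?_ r c hr hc (fun i => ?_) (fun j => ?_)
  · intro k' r' c' hr' hc'
    exact BandTwoTN.bidiag_minor_nonneg (fun _ => 1) e (fun _ => one_pos) he r' c' hr' hc'
  · intro k' r' c' hr' hc' _ _
    exact hM k' r' c' hr' hc'
  · intro n t hnt
    rw [if_neg (by omega), if_neg (by omega)]
  · have : r i ≤ univ.sup r := Finset.le_sup (f := r) (mem_univ i)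
    omega
  · have : c j ≤ univ.sup c := Finset.le_sup (f := c) (mem_univ j)
    omega

end HurwitzPair

end Summit.CriticalPhenomena.PercolationContinuityZ3.Theorems
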